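import Summits.BirchSwinnertonDyer.Rank1Residual.Additive.QuadraticBranchPAdicGrossZagierValuation
import Summits.BirchSwinnertonDyer.Rank1Residual.Additive.KatoDescentRankOnePerrinRiou
import HarnessLib

/-!
# T-e2-D — the η-BRANCH DERIVATIVE DICTIONARY D_η, TYPED: ONE displayed reading (the valuation
# dictionary `v_p(coeff₁ L_p⁻(V, η, X)) = v_p ℒ(W, p) + 2ν`) and, PROVED over it, the bookkeeping
# **(C2_η-GZ)(W, p) ⟺ PR^×(W, p)** — x1b's `p`-adic Gross–Zagier valuation conjecture on the
# quadratic branch IS Perrin-Riou's conjecture up to a `p`-adic unit, with NO main conjecture, NO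
# control theorem and NO `p`-adic height (cell `bsd-potss`; planner finding `TARGET.md` v3 §0.5;
# typer cc-typer-5; the MC-free twin of kmc's part 7)

HONEST FRAMING (cell `bsd-potss`, `run/shared/lean/pub/bsd-potss/`, FULL-BSD rank-`≤ 1` programme
tranche 1b, rows B4/B8; typed against cell `b2b-bsdres`'s quadratic-branch chain —
`Additive/QuadraticBranchPAdicGrossZagierValuation.lean` ((C2_η-GZ), cc-typer-6 / x1b) and kmc's
`Additive/KatoDescentRankOnePerrinRiou.lean` (PR^× = `PerrinRiouUpToUnitAt PRRatio W p`)): NOTHING is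
asserted and no Literature fact is minted. The dictionary is the planner's finding D_η
(`pub/bsd-potss/TARGET.md` v3 §0.5, sha16 4198ea07c81c1e92, text kept in v4; referee `bsd-potss-ref`
g4 read of its claims (a)/(b): PASS / PASS with NOTES 1–3, `pub/bsd-potss/ref/DETA-READ-refg4.md`;
TARGET v4 §0.8 (6): those NOTES N1–N3 are binders of L-Kη, not of this schema); it enters
here ONLY as a hypothesis SCHEMA over kmc's interface predicate `PRRatio` (same genre as
`HasPRRatio` / `RankOneCountReading`), to be DISCHARGED by the cell's `-ctrl` seat from the local
theorem L-Kη; every theorem below displays it as a binder. (C2_η-GZ) keeps its EVIDENCE label,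
PR^× stays a conjecture node; nothing is booked; no mark of `RESIDUAL-MAP.md` moves; Gss2 / O5a /
O7-ss ∩ `e = 2` stay OPEN.

## The dictionary (TARGET v3 §0.5, planner g3; Kobayashi 2003 locators as printed)

Setting: `p` odd, `V/ℚ` good at `p` with `a_p(V) = 0`, `T = T_pV`, `η ≠ 1` the quadratic character
of `Δ = Gal(ℚ_p(ζ_p)/ℚ_p)`, `W = V ⊗ η` the Gss2 twin (`C • W.quadraticTwist p* = V`), `Λ = ℤ_p⟦X⟧`,
`I = XΛ`. (a) [L-Kη, to be PROVED — NOT verbatim in print; nearest: Kobayashi Prop. 8.23 / 8.24 +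
Thm. 6.2 (pp. 11, 22–23); rational form Lei–Loeffler–Zerbes 2011 Prop. 4.11 / Thm. 4.12 /
Lemma 5.5] the joint Coleman map `(Col⁺, Col⁻)∘ε_η : H¹_Iw(k_∞, T)^η ⥲ Λ^η ⊕ I^η` is an
isomorphism (referee NOTE 2: its injectivity needs "`H¹_Iw(k_∞,T)^η` torsion-free of `Λ^η`-rank 2",
to be displayed in L-Kη). (b) the derivative functional `Φ_η := (X⁻¹·ε_ηCol⁻(·))|_{X=0}` on
`H¹(k₀, T)^η = H¹(ℚ_p, T_pW)` restricts to a BIJECTION `H¹_f(ℚ_p, T_pW) ⥲ ℤ_p` (the plus condition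
is empty at the bottom layer, Def. 8.16; `H¹_+(k₀) = H¹_f(k₀)`, referee NOTE 3: display the
finite-index reading). (c) `W(ℚ_p)[p] = 0` is AUTOMATIC (`⊂ V(k₀)[p] = 0`, Prop. 8.7), `H¹_f ↔
W(ℚ_p) ⊗ ℤ_p ≅ ℤ_p` with a generator `g` of `v_p(log_{ω_W} g) = 0` (`[W₀(ℚ_p) : Ŵ(pℤ_p)] = p`), so a
rational point `P` of `p`-divisibility level `n` in `W(ℚ_p)` (x1b's binders `hdiv`/`hndiv`) has
`v_p(log_{ω_W} P) = n`, and `Φ_η = u_η·log_{ω_W}` on `H¹_f`, `u_η ∈ ℤ_p^×`. (d) Kato side: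
`coeff₁ L_p⁻(V, η, X) = (X⁻¹L⁻_η)(0) = η(−1)·Φ_η(loc (z^{η(−1)})^η₀)` (Thm. 6.3 p. 11 with the forced
zero (3.7) p. 7), and `z(V)^η ↔ z(W)` up to the twist constant `ρ`, `|ρ|_p = 1` (TARGET v3 §0.6 (3);
the Néron-period part is Pal 2012 Prop. 2.5 / Cor. 2.6 / Thm. 3.2: `ũ = 1` for `d = p*`); in analytic
rank `1`, `loc_p z(W)_ℚ ∈ H¹_f`, hence **`v_p(coeff₁ L_p⁻(V, η, X)) = v_p(log_{ω_W}(loc_p z(W)_ℚ)) =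
v_p ℒ(W, p) + 2n`**, `ℒ = log_ω(loc_p z)/log_ω(P)²` being EXACTLY kmc's Perrin-Riou ratio (the
MEANING of the interface `PRRatio W p ℒ`, module docstring of `KatoDescentRankOnePerrinRiou.lean`),
and `coeff₁ L_p⁻ ≠ 0 ⟺ ℒ ≠ 0` (`Φ_η` injective on `H¹_f`). Every minus function `L` with Kobayashi's
interpolation property (3.5) differs from `L_p⁻(V, η, X)` by a unit of `ℤ_p`
(`IsQuadraticBranchMinusLFunction.exists_units_smul_eq`), so the valuation statement is choice-free.
§1 below TYPES exactly the displayed conclusion of (c)+(d) — the part of D_η a consumer needs — as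
ONE reading; (a), (b) and the two unit statements are its proof obligations, named here and in
TARGET v3, not separate binders.

## What is proved over the reading (§2; TARGET v3 §0.5 (e), "COROLLARY (Q1/R23)")

(C2_η-GZ) = `QuadraticBranchPAdicGrossZagierValuationAt W p` unfolds
(`quadraticBranchPAdicGrossZagierValuationAt_iff_leadingTerm`) to: for all twin data / `f` / `ϖ` /
minus function `L` / generator `P` of level `n` / rational `q` with `L′(W,1)/(Ω_W·Reg W) = q`:
`coeff₁ L ≠ 0 ∧ v_p(coeff₁ L) = 2n + ord_p q`. PR^× = `PerrinRiouUpToUnitAt PRRatio W p` says: in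
analytic rank one `∃ ℒ, PRRatio W p ℒ ∧ ℒ ≠ 0 ∧ ∃ q, L′(W,1)/(Ω_W·Reg W) = q ∧ v_p ℒ = ord_p q`. With
the dictionary `v_p(coeff₁ L) = v_p ℒ + 2n` the two say the same thing:
* `pAdicGrossZagierValuation_of_perrinRiouUpToUnit_of_dictionary` — **PR^×(W) ⟹ (C2_η-GZ)(W, p)**
  in analytic rank one (no further data: (C2_η-GZ) supplies its own binders);
* `perrinRiouUpToUnit_of_pAdicGrossZagierValuation_of_dictionary` — **(C2_η-GZ)(W, p) ⟹ PR^×(W)**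
  GIVEN a witness of (C2_η-GZ)'s binders at the pair (twin `V`, `C`, newform `f`, period ratio `ϖ`,
  a minus function `L`, `W(ℚ_p)[p] = 0`, a generator `P` of level `n`), the realizability reading
  `HasPRRatio` (kmc's Reading 4, under `Addv W p`, `0 ≤ ord_p j(W)`, (12.5.2)) and a RATIONAL value
  `q` of `L′(W,1)/(Ω_W·Reg W)` (Gross–Zagier + modularity; displayed, supplied by the caller);
* `pAdicGrossZagierValuation_iff_perrinRiouUpToUnit_of_dictionary` — the `↔` under those binders.
Consequences (TARGET v3 §0.5 (f), nothing booked): x1b's (C2_η-GZ) EVIDENCE (318 Gss2 rank-1 pairs,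
26 primes, 0 exceptions) reads as numerical evidence for Perrin-Riou's conjecture at ADDITIVE
potentially supersingular primes (in print a theorem only for `p ∤ 2N`: Burungale–Skinner–Tian–Wan
§6); PR^× rows feed x1b's signed chain (p307042) and (C2_η-GZ) rows feed kmc's Kato chain
(`rankOne_missingPPartAt_of_kmc_of_perrinRiou`, part 6) — modulo this reading.

WHAT THIS IS NOT. Not a proof of L-Kη, of Kato's Thm. 6.3 in the tree, of (C2_η-GZ) or of PR^× for
any curve; no Coleman map, zeta element, `log_ω` or `ℒ` is constructed (interfaces: `PRRatio` is a
section variable exactly as in kmc's files); nothing at `p = 2`, nothing for `a_p(V) ≠ 0`, nothing in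
analytic rank `≠ 1`; (C2_η-GZ) carries `5 ≤ p` in its own binders, so the `⟸` direction holds at every
odd `p` only in the sense that (C2_η-GZ) is vacuous below `5` — the `p = 3` share is the re-typing
item T-e2-p3. Net debt `0`: one hypothesis schema (a `def` over the interface variable `PRRatio`),
theorems otherwise; no `sorry`, axioms standard.

References: S. Kobayashi, Invent. Math. 152 (2003): (3.5)–(3.7) (p. 7), §4 (p. 8), Thm. 6.2–6.3
(p. 11), Prop. 8.7 (p. 16), Def. 8.16 (p. 19), Prop. 8.23–8.24 (pp. 22–23) [Kobayashi2003];
Burns–Kurihara–Sano arXiv:1910.07404, Thm. 1.4, Conj. 1.5, Rem. 1.7 (i) [BurnsKuriharaSano2019];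
B. Perrin-Riou, Ann. Inst. Fourier 43 (1993) §3.3 [PerrinRiou1993AIF]; K. Kato, Astérisque 295 (2004)
Thm. 12.5, (12.5.2) [Kato2004Asterisque]; A. Pal, Proc. AMS 140 (2012) Prop. 2.5, Cor. 2.6, Thm. 3.2
[Pal2012]; A. Lei, D. Loeffler, S. L. Zerbes, arXiv:1006.5163 Prop. 4.11, Thm. 4.12, Lemma 5.5
(nearest print for (a), rational form); R. L. Miller, LMS JCM 14 (2011) Def. 1.1 [Miller2011LMS].
-/

set_option autoImplicit false

noncomputable section

open scoped Classical MatrixGroups ModularForm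

open CongruenceSubgroup WeierstrassCurve Literature.NumberTheory.EllipticCurves
  Literature.NumberTheory.EllipticCurves.ModularForms
  Literature.NumberTheory.EllipticCurves.Kobayashi2003
  Literature.NumberTheory.EllipticCurves.Rank1Residual
  Literature.NumberTheory.EllipticCurves.Rank1Residual.Typed
  Literature.NumberTheory.EllipticCurves.IwasawaAlgebra

namespace Summit.BirchSwinnertonDyer.Rank1Residual.Additive

/-! ## §1 The dictionary as ONE displayed reading (hypothesis schema over `PRRatio`; nothing asserted) -/

/-- **D_η — THE η-BRANCH DERIVATIVE DICTIONARY, valuation form (TARGET v3 §0.5 (c)+(d); hypothesis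
SCHEMA over kmc's interface `PRRatio`; to be DISCHARGED from the local theorem L-Kη (§0.5 (a),(b)) +
Kobayashi's Thm. 6.3 read on the component `η` + the unit twist reading `ρ`; NOTHING asserted).** In
the binder shape of (C2_η-GZ) (`quadraticBranchPAdicGrossZagierValuationAt_iff_leadingTerm`), at
every odd `p`: for `W/ℚ` globally minimal of analytic rank one, a globally minimal twin
`C • W^{(p*)} = V` good at `p` with `a_p(V) = 0` and newform `f`, the period ratio `ϖ` of the parity
of `η`, EVERY `L` with Kobayashi's minus interpolation property `IsQuadraticBranchMinusLFunction f p ϖ L`,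
`W(ℚ_p)` without points of order `p` (automatic, Prop. 8.7 — displayed to match (C2_η-GZ)), a
generator `P` of `W(ℚ)` modulo torsion whose image in `W(ℚ_p)` is divisible by `pⁿ` and not by
`pⁿ⁺¹`, and EVERY `ℒ` with `PRRatio W p ℒ` (kmc's Perrin-Riou ratio `log_ω(loc_p z)/log_ω(P)²` of
Kato's zeta element): **`coeff₁ L ≠ 0 ↔ ℒ ≠ 0`, and if `ℒ ≠ 0` then
`v_p(coeff₁ L) = v_p ℒ + 2n`** (`coeff₁ L = (X⁻¹L)(0)` because `L(0) = 0` is forced, (3.7);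
`= η(−1)·Φ_η(loc z)` by Thm. 6.3; `Φ_η = u_η·log_{ω_W}` on `H¹_f(ℚ_p, T_pW)` by L-Kη (b);
`v_p(log_{ω_W} P) = n` by (c); `|ρ|_p = |u_η|_p = 1`). The OFFSET IS ZERO — the planner's `κ_η = 0`
(TARGET v3 R31: Pal's `ũ = 1` for `d = p*` and the admissible-`γ` convention inside `PRRatio`); with
any other universal offset the two typed nodes (C2_η-GZ) (offset `δ = 0`,
`QuadraticBranchPAdicGrossZagierValuationAt.offset_eq_zero`) and PR^× could not both hold at a pair
with a witness, so this reading is EXACTLY their consistency statement — a refutation of either at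
one certified pair refutes it.
[cite: Kobayashi2003, (3.7) (p. 7), Thm. 6.3 (p. 11), Prop. 8.7 (p. 16), Def. 8.16 (p. 19), Prop. 8.23–8.24 (pp. 22–23)]
[cite: BurnsKuriharaSano2019, Thm. 1.4 and Remark 1.7 (i)] [cite: Kato2004Asterisque, Thm. 12.5 (1) and (12.5.2) (p. 222)]
[cite: Pal2012, Prop. 2.5, Cor. 2.6 and Thm. 3.2] -/
def EtaBranchDerivativeDictionary
    (PRRatio : ∀ (W : WeierstrassCurve ℚ) [W.IsElliptic] [W.IsGloballyMinimal] (p : ℕ)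
      [Fact p.Prime], ℚ_[p] → Prop) : Prop :=
  ∀ (W : WeierstrassCurve ℚ) [W.IsElliptic] [W.IsGloballyMinimal] (p : ℕ) [Fact p.Prime]
    (V : WeierstrassCurve ℚ) [V.IsElliptic] [V.IsGloballyMinimal] (C : VariableChange ℚ)
    {N : ℕ} [NeZero N] {f : CuspForm (Gamma0 N) 2},
    p ≠ 2 → C • W.quadraticTwist ((-1) ^ (p / 2) * p) = V →
    V.HasGoodReductionAtPrime p → V.frobeniusTrace p = 0 → W.analyticRank = 1 →
    IsNewformOf V f →
    ∀ (ϖ : ℚ), (if Even (p / 2) then (ϖ : ℝ) * V.realPeriodRat = plusPeriod f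
        else (ϖ : ℝ) * V.imaginaryPeriodRat = minusPeriod f) →
    ∀ (L : IwasawaAlgebra p), IsQuadraticBranchMinusLFunction f p ϖ L →
    (∀ Q : (W.baseChange ℚ_[p]).toAffine.Point, p • Q = 0 → Q = 0) →
    ∀ (P : W.toAffine.Point) (n : ℕ), ¬ IsOfFinAddOrder P →
    (∀ R : W.toAffine.Point, ∃ (k : ℤ) (T : W.toAffine.Point), IsOfFinAddOrder T ∧ R = k • P + T) →
    (∃ Q : (W.baseChange ℚ_[p]).toAffine.Point, p ^ n • Q = W.toPadicPoint p P) →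
    (∀ Q : (W.baseChange ℚ_[p]).toAffine.Point, p ^ (n + 1) • Q ≠ W.toPadicPoint p P) →
    ∀ (ℒ : ℚ_[p]), PRRatio W p ℒ →
    (PowerSeries.coeff 1 L ≠ 0 ↔ ℒ ≠ 0) ∧
      (ℒ ≠ 0 → ((PowerSeries.coeff 1 L : ℤ_[p]) : ℚ_[p]).valuation = ℒ.valuation + 2 * (n : ℤ))

section Dictionary

variable {PRRatio : ∀ (W : WeierstrassCurve ℚ) [W.IsElliptic] [W.IsGloballyMinimal] (p : ℕ)
  [Fact p.Prime], ℚ_[p] → Prop}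

/-! ## §2 (C2_η-GZ) ⟺ PR^× over the dictionary (TARGET v3 §0.5 (e); bookkeeping) -/

/-- The two spellings of the BSD quotient `L′(W,1)/(Ω_W·Reg W)` agree (cast bookkeeping between
x1b's `((Ω_W * Reg W : ℝ) : ℂ)` and kmc's `(Ω_W : ℂ) * (Reg W : ℂ)`). [folklore] -/
theorem leadingLCoeff_div_realPeriodRat_mul_regulator_cast (W : WeierstrassCurve ℚ) [W.IsElliptic] :
    W.leadingLCoeff / ((W.realPeriodRat * W.regulator : ℝ) : ℂ) =
      W.leadingLCoeff / ((W.realPeriodRat : ℂ) * (W.regulator : ℂ)) := by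
  rw [Complex.ofReal_mul]

/-- **PR^×(W) ⟹ (C2_η-GZ)(W, p), over the dictionary** (analytic rank one; no further data — the
conjecture (C2_η-GZ) quantifies over its own witnesses): given `ℒ₀ ≠ 0` with `PRRatio W p ℒ₀` and
`v_p ℒ₀ = ord_p q₀`, `q₀ = L′(W,1)/(Ω_W·Reg W)`, the dictionary at any of (C2_η-GZ)'s data gives
`coeff₁ L ≠ 0` and `v_p(coeff₁ L) = v_p ℒ₀ + 2n = 2n + ord_p q` (`q = q₀` as complex numbers, hence as
rationals). [cite: Kobayashi2003, (3.7) (p. 7), Thm. 6.3 (p. 11)] [cite: BurnsKuriharaSano2019, Conj. 1.5 and Remark 1.7 (i)] -/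
theorem pAdicGrossZagierValuation_of_perrinRiouUpToUnit_of_dictionary
    (hD : EtaBranchDerivativeDictionary PRRatio)
    (W : WeierstrassCurve ℚ) [W.IsElliptic] [W.IsGloballyMinimal] (p : ℕ) [Fact p.Prime]
    (hr : W.analyticRank = 1) (hPR : PerrinRiouUpToUnitAt PRRatio W p) :
    QuadraticBranchPAdicGrossZagierValuationAt W p := by
  obtain ⟨ℒ₀, hℒ₀, hℒ₀ne, q₀, hq₀, hv₀⟩ := hPR hr
  rw [quadraticBranchPAdicGrossZagierValuationAt_iff_leadingTerm]
  intro V _ _ C N _ f hp5 hV hgood hap _ hf ϖ hϖ L hL htors P n hP hgen hdiv hndiv q hq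
  have hp2 : p ≠ 2 := by omega
  obtain ⟨hiff, hval⟩ :=
    hD W p V C hp2 hV hgood hap hr hf ϖ hϖ L hL htors P n hP hgen hdiv hndiv ℒ₀ hℒ₀
  have hqq : q = q₀ := by
    rw [leadingLCoeff_div_realPeriodRat_mul_regulator_cast] at hq
    exact_mod_cast hq.symm.trans hq₀
  refine ⟨hiff.mpr hℒ₀ne, ?_⟩
  rw [hval hℒ₀ne, hv₀, hqq]
  ring

/-- **(C2_η-GZ)(W, p) ⟹ PR^×(W), over the dictionary**, GIVEN a witness of (C2_η-GZ)'s binders at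
the pair (`5 ≤ p`; twin `V`, `C`; newform `f`; period ratio `ϖ`; a minus function `L`;
`W(ℚ_p)[p] = 0`; a generator `P` of `p`-divisibility level `n`), kmc's realizability reading
`HasPRRatio` (under `Addv W p`, `0 ≤ ord_p j(W)`, (12.5.2)) and a RATIONAL value `q` of
`L′(W,1)/(Ω_W·Reg W)` (displayed; Gross–Zagier + modularity supply it): (C2_η-GZ) at the witness gives
`coeff₁ L ≠ 0` and `v_p(coeff₁ L) = 2n + ord_p q`; the dictionary at the realised `ℒ` gives `ℒ ≠ 0`
and `v_p(coeff₁ L) = v_p ℒ + 2n`; hence `v_p ℒ = ord_p q`.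
[cite: Kobayashi2003, (3.7) (p. 7), Thm. 6.3 (p. 11)] [cite: BurnsKuriharaSano2019, Conj. 1.5 and Remark 1.7 (i)]
[cite: Kato2004Asterisque, Thm. 12.5 (4) and (12.5.2) (p. 222)] -/
theorem perrinRiouUpToUnit_of_pAdicGrossZagierValuation_of_dictionary
    (hD : EtaBranchDerivativeDictionary PRRatio) (hPR4 : HasPRRatio PRRatio)
    (W : WeierstrassCurve ℚ) [W.IsElliptic] [W.IsGloballyMinimal] (p : ℕ) [Fact p.Prime]
    (V : WeierstrassCurve ℚ) [V.IsElliptic] [V.IsGloballyMinimal] (C : VariableChange ℚ)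
    {N : ℕ} [NeZero N] {f : CuspForm (Gamma0 N) 2} (hp5 : 5 ≤ p)
    (hV : C • W.quadraticTwist ((-1) ^ (p / 2) * p) = V) (hgood : V.HasGoodReductionAtPrime p)
    (hap : V.frobeniusTrace p = 0) (hr : W.analyticRank = 1) (hf : IsNewformOf V f) (ϖ : ℚ)
    (hϖ : if Even (p / 2) then (ϖ : ℝ) * V.realPeriodRat = plusPeriod f
      else (ϖ : ℝ) * V.imaginaryPeriodRat = minusPeriod f)
    (L : IwasawaAlgebra p) (hL : IsQuadraticBranchMinusLFunction f p ϖ L)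
    (htors : ∀ Q : (W.baseChange ℚ_[p]).toAffine.Point, p • Q = 0 → Q = 0)
    (P : W.toAffine.Point) (n : ℕ) (hP : ¬ IsOfFinAddOrder P)
    (hgen : ∀ R : W.toAffine.Point, ∃ (k : ℤ) (T : W.toAffine.Point),
      IsOfFinAddOrder T ∧ R = k • P + T)
    (hdiv : ∃ Q : (W.baseChange ℚ_[p]).toAffine.Point, p ^ n • Q = W.toPadicPoint p P)
    (hndiv : ∀ Q : (W.baseChange ℚ_[p]).toAffine.Point, p ^ (n + 1) • Q ≠ W.toPadicPoint p P)
    (hadd : Addv W p) (hj : 0 ≤ padicValRat p W.j) (hK : Kato2004.ImageContainsSL2 W p)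
    (q : ℚ) (hq : W.leadingLCoeff / ((W.realPeriodRat : ℂ) * (W.regulator : ℂ)) = (q : ℂ))
    (h2 : QuadraticBranchPAdicGrossZagierValuationAt W p) : PerrinRiouUpToUnitAt PRRatio W p := by
  intro _
  have hp2 : p ≠ 2 := by omega
  obtain ⟨ℒ, hℒ⟩ := hPR4 W p hr hp2 hadd hj hK
  have hq' : W.leadingLCoeff / ((W.realPeriodRat * W.regulator : ℝ) : ℂ) = (q : ℂ) := by
    rw [leadingLCoeff_div_realPeriodRat_mul_regulator_cast]; exact hq
  obtain ⟨hne, hvq⟩ := (quadraticBranchPAdicGrossZagierValuationAt_iff_leadingTerm W p).mp h2 V C hp5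
    hV hgood hap hr hf ϖ hϖ L hL htors P n hP hgen hdiv hndiv q hq'
  obtain ⟨hiff, hval⟩ :=
    hD W p V C hp2 hV hgood hap hr hf ϖ hϖ L hL htors P n hP hgen hdiv hndiv ℒ hℒ
  have hℒne : ℒ ≠ 0 := hiff.mp hne
  refine ⟨ℒ, hℒ, hℒne, q, hq, ?_⟩
  have h := hval hℒne
  rw [hvq] at h
  linarith

/-- **(C2_η-GZ)(W, p) ⟺ PR^×(W) over the dictionary**, under the binders of the `⟹` direction
(TARGET v3 §0.5 (e): "on the quadratic branch the `p`-adic Gross–Zagier law IS Perrin-Riou's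
conjecture read through Kobayashi's odd Coleman map" — here as kernel bookkeeping modulo the ONE
displayed reading). [cite: Kobayashi2003, (3.7) (p. 7), Thm. 6.3 (p. 11)] [cite: BurnsKuriharaSano2019, Conj. 1.5 and Remark 1.7 (i)]
[cite: PerrinRiou1993AIF, §3.3] -/
theorem pAdicGrossZagierValuation_iff_perrinRiouUpToUnit_of_dictionary
    (hD : EtaBranchDerivativeDictionary PRRatio) (hPR4 : HasPRRatio PRRatio)
    (W : WeierstrassCurve ℚ) [W.IsElliptic] [W.IsGloballyMinimal] (p : ℕ) [Fact p.Prime]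
    (V : WeierstrassCurve ℚ) [V.IsElliptic] [V.IsGloballyMinimal] (C : VariableChange ℚ)
    {N : ℕ} [NeZero N] {f : CuspForm (Gamma0 N) 2} (hp5 : 5 ≤ p)
    (hV : C • W.quadraticTwist ((-1) ^ (p / 2) * p) = V) (hgood : V.HasGoodReductionAtPrime p)
    (hap : V.frobeniusTrace p = 0) (hr : W.analyticRank = 1) (hf : IsNewformOf V f) (ϖ : ℚ)
    (hϖ : if Even (p / 2) then (ϖ : ℝ) * V.realPeriodRat = plusPeriod f
      else (ϖ : ℝ) * V.imaginaryPeriodRat = minusPeriod f)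
    (L : IwasawaAlgebra p) (hL : IsQuadraticBranchMinusLFunction f p ϖ L)
    (htors : ∀ Q : (W.baseChange ℚ_[p]).toAffine.Point, p • Q = 0 → Q = 0)
    (P : W.toAffine.Point) (n : ℕ) (hP : ¬ IsOfFinAddOrder P)
    (hgen : ∀ R : W.toAffine.Point, ∃ (k : ℤ) (T : W.toAffine.Point),
      IsOfFinAddOrder T ∧ R = k • P + T)
    (hdiv : ∃ Q : (W.baseChange ℚ_[p]).toAffine.Point, p ^ n • Q = W.toPadicPoint p P)
    (hndiv : ∀ Q : (W.baseChange ℚ_[p]).toAffine.Point, p ^ (n + 1) • Q ≠ W.toPadicPoint p P)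
    (hadd : Addv W p) (hj : 0 ≤ padicValRat p W.j) (hK : Kato2004.ImageContainsSL2 W p)
    (q : ℚ) (hq : W.leadingLCoeff / ((W.realPeriodRat : ℂ) * (W.regulator : ℂ)) = (q : ℂ)) :
    QuadraticBranchPAdicGrossZagierValuationAt W p ↔ PerrinRiouUpToUnitAt PRRatio W p :=
  ⟨perrinRiouUpToUnit_of_pAdicGrossZagierValuation_of_dictionary hD hPR4 W p V C hp5 hV hgood hap hr
      hf ϖ hϖ L hL htors P n hP hgen hdiv hndiv hadd hj hK q hq,
    pAdicGrossZagierValuation_of_perrinRiouUpToUnit_of_dictionary hD W p hr⟩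

/-- **The dictionary pins the nonvanishing side too: over it, PR^×'s `ℒ ≠ 0` is (C2_η-GZ)'s
`coeff₁ L ≠ 0` at any witness** (bookkeeping; the analytic content — `loc_p z(W)_ℚ ≠ 0 ⟺
L′(W,1) ≠ 0` — is Kato's Thm. 12.5 + Gross–Zagier–Kolyvagin, not used here).
[cite: Kobayashi2003, Thm. 6.3 (p. 11)] [cite: Kato2004Asterisque, Thm. 12.5 (p. 222)] -/
theorem coeff_one_ne_zero_iff_of_dictionary (hD : EtaBranchDerivativeDictionary PRRatio)
    (W : WeierstrassCurve ℚ) [W.IsElliptic] [W.IsGloballyMinimal] (p : ℕ) [Fact p.Prime]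
    (V : WeierstrassCurve ℚ) [V.IsElliptic] [V.IsGloballyMinimal] (C : VariableChange ℚ)
    {N : ℕ} [NeZero N] {f : CuspForm (Gamma0 N) 2} (hp2 : p ≠ 2)
    (hV : C • W.quadraticTwist ((-1) ^ (p / 2) * p) = V) (hgood : V.HasGoodReductionAtPrime p)
    (hap : V.frobeniusTrace p = 0) (hr : W.analyticRank = 1) (hf : IsNewformOf V f) (ϖ : ℚ)
    (hϖ : if Even (p / 2) then (ϖ : ℝ) * V.realPeriodRat = plusPeriod f
      else (ϖ : ℝ) * V.imaginaryPeriodRat = minusPeriod f)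
    (L : IwasawaAlgebra p) (hL : IsQuadraticBranchMinusLFunction f p ϖ L)
    (htors : ∀ Q : (W.baseChange ℚ_[p]).toAffine.Point, p • Q = 0 → Q = 0)
    (P : W.toAffine.Point) (n : ℕ) (hP : ¬ IsOfFinAddOrder P)
    (hgen : ∀ R : W.toAffine.Point, ∃ (k : ℤ) (T : W.toAffine.Point),
      IsOfFinAddOrder T ∧ R = k • P + T)
    (hdiv : ∃ Q : (W.baseChange ℚ_[p]).toAffine.Point, p ^ n • Q = W.toPadicPoint p P)
    (hndiv : ∀ Q : (W.baseChange ℚ_[p]).toAffine.Point, p ^ (n + 1) • Q ≠ W.toPadicPoint p P)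
    (ℒ : ℚ_[p]) (hℒ : PRRatio W p ℒ) :
    PowerSeries.coeff 1 L ≠ 0 ↔ ℒ ≠ 0 :=
  (hD W p V C hp2 hV hgood hap hr hf ϖ hϖ L hL htors P n hP hgen hdiv hndiv ℒ hℒ).1

end Dictionary

end Summit.BirchSwinnertonDyer.Rank1Residual.Additive

end
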